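import Summits.QuantumFields.YangMills.Theorems.UnitScaleTiltProp8HalvingA1Row165
import Summits.QuantumFields.YangMills.Theorems.UnitScaleTiltProp8HalvingMultiplierLetter
import HarnessLib

/-!
# Route `UnitScaleTilt`, crux K1 child «MinimiserStabilityRegPr» (stmt-QuantumFields-19200), registered stub V2′ `stub_halvingStep`
# (skeletons v8 5b4e846794b80374 / v10 `BirthV10`) — **THE (165)-A₁ ROW OF THE HALVING PACKAGE WITH THE E–L JUNCTION DISCHARGED** (owner socket (σ-3), file 4,
# the one-stop knit): ★w5-19200 g2's `HalvingA1Row165.row165_of_smallSolution_layer` (the three (165)-A₁ conjuncts of `HalvingAssembly(Interior).H_of_package(Int)`)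
# with its two displayed E–L inputs PROVED — `hEL` (the Δ-row identity `∂*∂A₁ = −W + 𝔐W` on the slice, `HalvingELJunction.flatStencil_eq_of_slice`) and `hMl`
# (the multiplier letter on the layer, `HalvingMultiplierLetter.multiplierLetter_layer`) — so that the row now reads, BY NAME, from: P2's objects and letters at
# the cube sequence (`IsFlatH`∕`IsFlatGt`, `GtSupLetterG`, `HDecayLetterD`, `RowSum162`, the band `G`-row of `FlatPortGBandL0`, `QContrLetter`), the F4 solution
# of (158) w.r.t. the kernel extension of P2's `G̃`, Prop. 4's (98), the (152) sizes, and the residual-Landau slice (153) of the chart field read on `A₁`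

Cell `ym3-torus` (HUMAN RULING D-0037, YM ladder rung R3 — continuum SU(2) YM₃ on the torus is a RUNG, not the Clay problem), width seat
`ym-ust-19200-w3` gen 3 (D-0149).  `--supports stmt-QuantumFields-19200 --as helper`; def-free, 0 sorry, standard axioms.

THE PRINT ([Balaban1985Variational] p. 304 (165)): *«|A|, |∇^ηA|, |d^{η*}d^ηA|, |Δ^ηA| < ¼M_Δmax{B₃ε₁, ½ε₀} + B₀C₄(36dL²B₁Mε₀)² + B₀4C₂(36dL²B₁Mε₀)²»* — the middle term for
`A₁`: the first two letters from `G̃`'s rows and (98) (F4), the second-order one on the gauge slice through (128)∕(131)–(133) (p. 297–298: `Δ_aA₀ = −P₀ᵀW`, «the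
right-hand side of (133) can be estimated by O(1)…»).

WHAT THIS FILE PROVES (no definition, no sorry): **`row165_of_slice`** — at the cube sequence `cubeSeqMT3 F n K x ρ S M` (`ρ ≥ 1`) with its level weights `w`:
GIVEN P2's pinned `H` (`IsFlatH`, with its (161)₁ rows `HDecayLetterD` over a distance `dBI ≥ distBI` and the (162) row sum), P2's pinned `G̃` (`IsFlatGt`, with the sup
letter `GtSupLetterG … B_G`), a band `G`-package (`IsFlatGW` at weights `a(c) ≤ (L^{K−n})²L^{j(c)}` with `GtSupLetterG … C_G`), the contraction row `QContrLetter … C_Q`, the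
`ℂ`-linear kernel extension `G` of `G̃` to `𝔤`-valued currents, a current map `W` with (98) (`hWq`, radius `a₃`, constant `C₄`), a solution `A₁ + G(W(A₁ + 𝔄)) = 0` of
(158) whose `(152)`-sizes are `≤ r < a₃`, and THE SLICE `R∂*(φ∘A₁) = 0` for every `ℝ`-linear reading `φ` — THEN the three (165)-A₁ conjuncts of the package hold on the
layer of the one-point top family at `x` with `e ≥ max{B_G, 1 + (B₀B₃ + 1)C_QC_G}·C₄r²`.
HONEST SCOPE.  A composition of ★w5's knit with files 1–3 of this seat; the pillars' content (F4's solution, P3b's (98), P1's (152)∕(153), P2's letters — ✓ for odd `L ≥ 5`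
on big tori) stays displayed.  NOT a claim about the crux, the rung, or the mass gap.

References: T. Bałaban, CMP **102** (1985) 277–309 [Balaban1985Variational] (128) p.297, (131)–(133) p.298, (152)–(153) p.301, (158) p.302, (161)–(163) p.303, (165) p.304;
CMP **96** (1984) 223–250 [Balaban1984PropagatorsII] (2.16) p.225, (2.19) p.226, (2.35) p.228.
-/

set_option autoImplicit false

noncomputable section

open scoped BigOperators InnerProductSpace Matrix.Norms.L2Operator

namespace Summit.QuantumFields.YangMills.Theorems.HalvingA1Row165EL

open Literature.MathematicalPhysics.QuantumFieldTheory.Balaban1983to89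
open B5Eq117TorusCarriers (Mk)
open B5Eq118OneStroke (iterBlockOf)
open B5Prop12FieldsLattice (distSite distSite_nonneg)
open B6SectAOperatorsV1 (BondIdx QE QsE RE dsE)
open B6SectAVectorModelV1 (GE EE)
open B8Ineq132 (BondTouches)
open B8Eq140Level (SideTouches)
open B8Eq143PlaqExpansion (pdiv)
open B8Eq146AExpansion (plaqCovDeriv)
open B8Thm2SetupTorus (pullDom)
open B10Eq27TorusAxialLog (pull transl)
open T3ContinuumYM3Torus (T3Family)
open FlatCubeOpsText (IsLevWeight IsFlatH IsFlatGt distBI HDecayLetterD RowSum162 GtSupLetterG)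
open FlatOpsLettersAssembly (flatH IsFlatGW QContrLetter levWeight_nonneg)
open FlatCubeSequenceAligned (cubeSeqMT3)
open HalvingELJunction (flatStencil_eq_of_slice exists_Mop)
open HalvingMultiplierLetter (multiplierLetter_layer)
open HalvingGtMatrix (matrixGtSup)
open HalvingA1Row165 (row165_of_smallSolution_layer)

variable {F : T3Family} {n K : ℕ}

/-- **THE (165)-A₁ ROW WITH THE E–L JUNCTION DISCHARGED** — see the module docstring; the conclusion is LITERALLY that of
`HalvingA1Row165.row165_of_smallSolution_layer` (the three (165)-A₁ conjuncts of `HalvingAssembly.H_of_package`∕`HalvingAssemblyInterior.H_of_packageInt` with bound `e`).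
[cite: Balaban1985Variational, (128) p.297, (131)-(133) p.298, (152)-(153) p.301, (158) p.302, (165) p.304; Balaban1984PropagatorsII, (2.16) p.225, (2.35) p.228] -/
theorem row165_of_slice (hnK : n < K) (x : Site (F.P K) 0) (ρ S M : ℕ) (hM : 1 ≤ M) (hρ1 : 1 ≤ ρ)
    {w : ℕ → PBond (F.P K) 0 → ℝ} (hw : IsLevWeight F n K (cubeSeqMT3 F n K x ρ S M hM) w)
    -- P2's `H` and its rows at the cube sequence
    {H : (BondIdx (cubeSeqMT3 F n K x ρ S M hM) → ℝ) →ₗ[ℝ] (PBond (F.P K) 0 → ℝ)} (hHF : IsFlatH F n K (cubeSeqMT3 F n K x ρ S M hM) H)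
    {dBI : PBond (F.P K) 0 → BondIdx (cubeSeqMT3 F n K x ρ S M hM) → ℝ} {δ₀ B₀ B₃ BG CG CQ C₄ a₃ r e : ℝ}
    (hH : HDecayLetterD F n K (cubeSeqMT3 F n K x ρ S M hM) dBI w H B₀ δ₀) (h162 : RowSum162 F n K (cubeSeqMT3 F n K x ρ S M hM) dBI w δ₀ B₃)
    (hdom : ∀ b c, distBI (cubeSeqMT3 F n K x ρ S M hM) b c ≤ dBI b c) (hδ₀ : 0 ≤ δ₀) (hB₀ : 0 ≤ B₀) (hB₃ : 0 ≤ B₃)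
    -- P2's `G̃` and its sup letter
    {Gt : (PBond (F.P K) 0 → ℝ) →ₗ[ℝ] (PBond (F.P K) 0 → ℝ)} (hGt : IsFlatGt F n K (cubeSeqMT3 F n K x ρ S M hM) Gt) (hGtsup : GtSupLetterG F n K w Gt BG)
    -- the band `G`-package and the contraction row
    {w' : BondIdx (cubeSeqMT3 F n K x ρ S M hM) → ℝ} (hw' : ∀ i, 0 < w' i)
    {Ga : (PBond (F.P K) 0 → ℝ) →ₗ[ℝ] (PBond (F.P K) 0 → ℝ)} (hGW : IsFlatGW F n K (cubeSeqMT3 F n K x ρ S M hM) hw' Ga) (hGasup : GtSupLetterG F n K w Ga CG)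
    (hband : ∀ c : BondIdx (cubeSeqMT3 F n K x ρ S M hM), w' c ≤ ((F.L : ℝ) ^ (K - n)) ^ 2 * (F.L : ℝ) ^ (c.1.1 : ℕ))
    (hQ : QContrLetter F n K (cubeSeqMT3 F n K x ρ S M hM) w CQ) (hCG : 0 ≤ CG) (hCQ : 0 ≤ CQ)
    -- the `ℂ`-linear kernel extension of `G̃`, the current map with (98), the solution of (158) and its (152) sizes
    (G : (PBond (F.P K) 0 → Matrix (Fin 2) (Fin 2) ℂ) →ₗ[ℂ] (PBond (F.P K) 0 → Matrix (Fin 2) (Fin 2) ℂ))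
    (hGker : ∀ (f : PBond (F.P K) 0 → Matrix (Fin 2) (Fin 2) ℂ) (b : PBond (F.P K) 0), G f b = ∑ b', Gt (Pi.single b' 1) b • f b')
    (W : (PBond (F.P K) 0 → Matrix (Fin 2) (Fin 2) ℂ) → (PBond (F.P K) 0 → Matrix (Fin 2) (Fin 2) ℂ))
    (hWq : ∀ (Y : PBond (F.P K) 0 → Matrix (Fin 2) (Fin 2) ℂ) (r' : ℝ), r' < a₃ → (∀ b, w 1 b * ‖Y b‖ ≤ r') →
      (∀ (b : PBond (F.P K) 0) (ν : Fin 3), w 2 b * (F.L : ℝ) ^ (K - n) * ‖Y ⟨b.src.shift ν, b.dir⟩ - Y b‖ ≤ r') →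
        ∀ b, w 3 b * ‖W Y b‖ ≤ C₄ * r' ^ 2)
    {A₁ 𝔄 : PBond (F.P K) 0 → Matrix (Fin 2) (Fin 2) ℂ} (hsol : A₁ + G (W (A₁ + 𝔄)) = 0) (hr : r < a₃)
    (h1 : ∀ b, w 1 b * ‖(A₁ + 𝔄) b‖ ≤ r)
    (h2 : ∀ (b : PBond (F.P K) 0) (ν : Fin 3), w 2 b * (F.L : ℝ) ^ (K - n) * ‖(A₁ + 𝔄) ⟨b.src.shift ν, b.dir⟩ - (A₁ + 𝔄) b‖ ≤ r)
    -- the slice (153), read on `A₁`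
    (hslice : ∀ φ : Matrix (Fin 2) (Fin 2) ℂ →ₗ[ℝ] ℝ,
      RE (cubeSeqMT3 F n K x ρ S M hM) ((F.L : ℝ) ^ (K - n)) (dsE ((F.L : ℝ) ^ (K - n)) (WithLp.toLp 2 (fun b => φ (A₁ b)))) = 0)
    -- the bound
    (he₁ : BG * (C₄ * r ^ 2) ≤ e) (he₂ : (1 + (B₀ * B₃ + 1) * CQ * CG) * (C₄ * r ^ 2) ≤ e) :
    (∀ (z : B7Prop1Explicit.Site (F.P K).d) (τ : Fin (F.P K).d),
      SideTouches (pullDom (fun j => if K - n ≤ j then ({x} : Set (Site (F.P K) 0)) else (∅ : Set (Site (F.P K) 0))) (K - n)) z τ →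
      ‖A₁ ⟨transl 0 z, τ⟩‖ ≤ e) ∧
    (∀ (z : B7Prop1Explicit.Site (F.P K).d) (κ τ : Fin (F.P K).d),
      SideTouches (pullDom (fun j => if K - n ≤ j then ({x} : Set (Site (F.P K) 0)) else (∅ : Set (Site (F.P K) 0))) (K - n)) z τ →
      ‖(((F.L : ℝ)⁻¹) ^ (K - n))⁻¹ • (A₁ ⟨(transl 0 z).shift κ, τ⟩ - A₁ ⟨transl 0 z, τ⟩)‖ ≤ e) ∧
    (∀ (z : B7Prop1Explicit.Site (F.P K).d) (μ : Fin (F.P K).d),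
      BondTouches (pullDom (fun j => if K - n ≤ j then ({x} : Set (Site (F.P K) 0)) else (∅ : Set (Site (F.P K) 0))) (K - n)) z μ →
      ‖pdiv (((F.L : ℝ)⁻¹) ^ (K - n)) (1 : B7Prop1Explicit.Site (F.P K).d → Fin (F.P K).d → (Matrix (Fin 2) (Fin 2) ℂ)ˣ)
          (plaqCovDeriv (((F.L : ℝ)⁻¹) ^ (K - n)) (1 : B7Prop1Explicit.Site (F.P K).d → Fin (F.P K).d → (Matrix (Fin 2) (Fin 2) ℂ)ˣ)
            (pull A₁ 0)) μ z‖ ≤ e) := by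
  have hw0 : ∀ m b, 0 ≤ w m b := levWeight_nonneg hw
  -- P2's `H` IS `flatH`
  have hHeq : H = flatH F n K (cubeSeqMT3 F n K x ρ S M hM) := by
    apply LinearMap.ext
    intro X
    funext b
    exact hHF X b
  rw [hHeq] at hH
  have hd : ∀ b c, 0 ≤ dBI b c := fun b c => by
    refine le_trans ?_ (hdom b c)
    unfold distBI
    exact mul_nonneg (by positivity) (distSite_nonneg _ _)
  -- the `G̃`-letters of the kernel extension (no component loss)
  have hG : ∀ (f : PBond (F.P K) 0 → Matrix (Fin 2) (Fin 2) ℂ) (β : ℝ), (∀ b, w 3 b * ‖f b‖ ≤ β) →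
      (∀ b, w 1 b * ‖G f b‖ ≤ BG * β) ∧
        ∀ (b : PBond (F.P K) 0) (ν : Fin 3), w 2 b * (F.L : ℝ) ^ (K - n) * ‖G f ⟨b.src.shift ν, b.dir⟩ - G f b‖ ≤ BG * β := by
    intro f β hf
    obtain ⟨b₀⟩ : Nonempty (PBond (F.P K) 0) := ⟨⟨fun _ => 0, ⟨0, lt_of_lt_of_le zero_lt_one (F.P K).hd⟩⟩⟩
    have hβ : 0 ≤ β := (mul_nonneg (hw0 3 b₀) (norm_nonneg _)).trans (hf b₀)
    exact matrixGtSup hGtsup hw0 hβ (fun b => hGker f b) hf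
  -- the multiplier operator and its layer letter
  obtain ⟨Mop, hMop⟩ := exists_Mop (F := F) (n := n) (K := K) (cubeSeqMT3 F n K x ρ S M hM)
  have hMl := multiplierLetter_layer hnK x ρ S M hM hρ1 hw hH h162 hδ₀ hB₀ hB₃ hd hw' hGW hGasup hband hQ hCG hCQ Mop hMop
  -- the Δ-row identity on the slice
  have hEL : ∀ (z : B7Prop1Explicit.Site (F.P K).d) (μ : Fin (F.P K).d),
      BondTouches (pullDom (fun j => if K - n ≤ j then ({x} : Set (Site (F.P K) 0)) else (∅ : Set (Site (F.P K) 0))) (K - n)) z μ →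
      pdiv (((F.L : ℝ)⁻¹) ^ (K - n)) (1 : B7Prop1Explicit.Site (F.P K).d → Fin (F.P K).d → (Matrix (Fin 2) (Fin 2) ℂ)ˣ)
          (plaqCovDeriv (((F.L : ℝ)⁻¹) ^ (K - n)) (1 : B7Prop1Explicit.Site (F.P K).d → Fin (F.P K).d → (Matrix (Fin 2) (Fin 2) ℂ)ˣ)
            (pull A₁ 0)) μ z =
        -(W (A₁ + 𝔄) ⟨transl 0 z, μ⟩) + (fun f b => ∑ b', Mop (Pi.single b' 1) b • f b') (W (A₁ + 𝔄)) ⟨transl 0 z, μ⟩ :=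
    fun z μ _ => flatStencil_eq_of_slice (cubeSeqMT3 F n K x ρ S M hM) hGt Mop hMop (w := W (A₁ + 𝔄)) (𝒢 := G (W (A₁ + 𝔄)))
      (fun b => hGker _ b) hsol hslice (fun _ => rfl) z μ
  exact row165_of_smallSolution_layer hnK x ρ S M hM hρ1 hw G W (fun f b => ∑ b', Mop (Pi.single b' 1) b • f b') hG hWq hMl hsol hr h1 h2
    hEL he₁ he₂

end Summit.QuantumFields.YangMills.Theorems.HalvingA1Row165EL

end
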